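import Literature.AlgebraicGeometry.Modules.RankOneEndomorphismScalar
import Mathlib.AlgebraicGeometry.FunctionField
import HarnessLib

/-!
# Sections and functionals of a line bundle: `μ(σ)` a unit ⇒ `E ≅ 𝒪`; on an integral scheme `μ ≠ 0`, `σ ≠ 0 ⇒ μ(σ) ≠ 0`

Layer `Literature/AlgebraicGeometry/Modules`, namespace `Literature.AlgebraicGeometry.Modules`.  THEOREMS ONLY (no
definition, no named fact, no instance, no `sorry`).  For a scheme `Y`, an `𝒪_Y`-module `E` locally free of rank one
(`Motives.HasRank E 1`), a global section `σ ∈ Γ(E, Y)` and a global functional `μ : E|_⊤ → 𝒪|_⊤` (a section of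
`E^∨`, in the tree's `E.over ⊤ ⟶ (unitModule Y).over ⊤` currency of `Modules/SheafHom`, values `appLE`):

* `eq_coord_smul_basisSection_of_unique`, `appLE_eq_coord_smul_of_unique` — rank-one frame calculus
  (`y = λ(y) b`, `χ(y) = λ(y) χ(b)`; `Modules/LocalFrames`);
* **`nonempty_iso_unit_of_section_dualSection`** — if `μ(σ) ∈ Γ(Y, 𝒪_Y)` is a UNIT then `E ≅ 𝒪_Y`: `r ↦ r σ`
  (`smulSection σ`) is an isomorphism with inverse `μ(σ)⁻¹ μ`, the identity `μ(σ)⁻¹ μ(x) σ = x` being checked on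
  rank-one frames (`σ| = a b`, `μ(b) = c`, `a c = μ(σ)|`) and glued by the sheaf property; the isomorphism over `⊤`
  descends by `Modules/RankOneCocycle.isoOfOverCover`;
* **`appLE_ne_zero_of_ne_zero`** — on an INTEGRAL `Y`, `σ ≠ 0` and `μ ≠ 0` imply `μ(σ) ≠ 0`: near a point where
  `σ| = a b ≠ 0`, `μ(σ)| = a μ(b)` in the domain `Γ(U, 𝒪_Y)`, so `μ(σ) = 0` forces `μ(b) = 0`, i.e. `μ|_U = 0`, hence
  `μ = 0` (restrict any value `μ(x)` to `W ∩ U ≠ ∅`).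

These are the two «section with unit pairing» bricks of the local seesaw argument (Mumford, *Abelian Varieties* §5,
proof of Cor. 6 / §10: a section of `L` and a section of `L⁻¹` pairing to a unit trivialise `L`; on an integral fibre
non-zero sections pair non-trivially).  Cell `hodgecm-mathlib`, M13 phase A node N1 (B-p01 (g11) 11:19Z bricks
(A)+(B), consumed by his (T-H2′)); generic, books 0; HC_CM is proved only modulo the printed citations until rung 0
closes.

Mathlib searched (pin v4.32): `germ_injective_of_isIntegral`, `TopCat.Presheaf.germ_res`, `nonempty_preirreducible_inter`,
`TopCat.Sheaf.isTerminalOfEqEmpty` + `CommRingCat.subsingleton_of_isTerminal`, `TopCat.Sheaf.eq_of_locally_eq'` (used).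

## References

* D. Mumford, *Abelian Varieties*, TIFR Studies in Mathematics 5 (1970), §5 Cor. 6 and its proof (p. 54), §10 (p. 89).
  [MumfordAV1970]
* R. Hartshorne, *Algebraic Geometry*, GTM 52 (1977), II.5 (p. 109), II Ex. 5.1 (b) (p. 123). [Hartshorne1977]
-/

noncomputable section

universe u

open CategoryTheory CategoryTheory.Limits AlgebraicGeometry TopologicalSpace Opposite

namespace Literature.AlgebraicGeometry.Modules

open Literature.AlgebraicGeometry.Motives

variable {Y : Scheme.{u}} {E : Y.Modules}

/-- In a rank-one frame `e : 𝒪 ≅ E|_W` (one-element index type) every section is its coordinate times the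
basis section: `y = λ(y) • b`. [cite: Hartshorne1977, II.5 (p. 109)] -/
theorem eq_coord_smul_basisSection_of_unique {W : Y.Opens} {I : Type u} [Unique I]
    (e : SheafOfModules.free I ≅ E.over W) (y : Γ(E, W)) :
    y = coord e (𝟙 W) y default • basisSection e default := by
  haveI : Fintype I := Fintype.ofFinite I
  conv_lhs => rw [eq_sum_coord_smul e (𝟙 W) y, Fintype.sum_unique, op_id, E.presheaf.map_id]
  rfl

/-- In a rank-one frame, a functional is evaluation against its value on the basis section:
`χ(y) = λ(y) • χ(b)`. [cite: Hartshorne1977, II Ex. 5.1 (p. 123)] -/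
theorem appLE_eq_coord_smul_of_unique {M : Y.Modules} {W : Y.Opens} {I : Type u} [Unique I]
    (e : SheafOfModules.free I ≅ E.over W) (χ : E.over W ⟶ M.over W) (y : Γ(E, W)) :
    appLE χ (𝟙 W) y = coord e (𝟙 W) y default • appLE χ (𝟙 W) (basisSection e default) := by
  haveI : Fintype I := Fintype.ofFinite I
  rw [appLE_eq_sum_coord e χ (𝟙 W) y, Fintype.sum_unique, op_id, E.presheaf.map_id]
  rfl

/-- **A rank-one module with a global section `σ` and a global functional `μ` such that `μ(σ)` is a unit
is trivial**: `r ↦ r · σ` is an isomorphism `𝒪_Y ⥲ E` with inverse `μ(σ)⁻¹ · μ` (checked on rank-one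
frames: `σ| = a b`, `μ(b) = c`, `a c = μ(σ)|` a unit forces `a` to be a unit).
[cite: Hartshorne1977, II Ex. 5.1 (b) (p. 123)] [cite: MumfordAV1970, §5 Cor. 6 (p. 54)] -/
theorem nonempty_iso_unit_of_section_dualSection (hE : HasRank E 1) (σ : Γ(E, ⊤))
    (μ : E.over ⊤ ⟶ (unitModule Y).over ⊤) (hp : IsUnit (M := Γ(Y, ⊤)) (appLE μ (𝟙 ⊤) σ)) :
    Nonempty (E ≅ unitModule Y) := by
  obtain ⟨F, hF⟩ := exists_frameSystem_of_hasRank hE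
  obtain ⟨q, hq⟩ := hp.exists_right_inv
  set p : Γ(Y, ⊤) := (show Γ(Y, ⊤) from appLE μ (𝟙 ⊤) σ) with hpdef
  -- the two morphisms over `⊤`
  let s : (unitModule Y).over ⊤ ⟶ E.over ⊤ := smulSection σ
  let t : E.over ⊤ ⟶ (unitModule Y).over ⊤ := q • μ
  -- naturality of `μ` on restrictions of `σ`: `μ(σ|_W) = p|_W`
  have hμσ : ∀ {W : Y.Opens} (k : W ⟶ ⊤),
      (appLE μ k (E.presheaf.map k.op σ) : Γ(Y, W)) = Y.presheaf.map k.op p := fun k => by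
    have h := appLE_map μ (𝟙 ⊤) k σ
    rw [Category.comp_id] at h
    exact h
  -- `s ≫ t = 𝟙`: `q| · μ(r σ|) = q| r p| = r`
  have hst : s ≫ t = 𝟙 _ := by
    refine hom_ext_of_appLE fun W k r => ?_
    rw [appLE_comp, appLE_id]
    set r' : Γ(Y, W) := (show Γ(Y, W) from r) with hr'
    change (show Γ(Y, W) from appLE t k (appLE s k r')) = r'
    have h1 : (show Γ(Y, W) from appLE t k (appLE s k r')) =
        Y.presheaf.map k.op q * (r' * (show Γ(Y, W) from appLE μ k (E.presheaf.map k.op σ))) := by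
      change appLE (q • μ) k (appLE (smulSection σ) k r') = _
      rw [appLE_smul, appLE_smulSection, appLE_smul_right]
      rfl
    rw [h1, hμσ, mul_left_comm, ← map_mul, mul_comm q p, hq, map_one, mul_one]
  -- `t ≫ s = 𝟙`: local on the rank-one frames
  have hts : t ≫ s = 𝟙 _ := by
    refine hom_ext_of_appLE fun W k x => ?_
    rw [appLE_comp, appLE_id]
    set c : Γ(Y, W) := (show Γ(Y, W) from appLE t k x) with hcdef
    have hc : c = Y.presheaf.map k.op q * (show Γ(Y, W) from appLE μ k x) := by
      rw [hcdef]
      change appLE (q • μ) k x = _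
      rw [appLE_smul]
      rfl
    change appLE (smulSection σ) k c = x
    rw [appLE_smulSection]
    refine TopCat.Sheaf.eq_of_locally_eq' (C := AddCommGrpCat.{u}) ⟨E.presheaf, E.isSheaf⟩
      (fun z : W => W ⊓ F.U z.1) W (fun z => homOfLE inf_le_left)
      (fun z hz => Opens.mem_iSup.mpr ⟨⟨z, hz⟩, hz, F.mem z⟩) _ _ fun ⟨z, hz⟩ => ?_
    haveI : Unique (F.I z) := ((F.enum z).trans (finCongr (hF z))).unique
    -- the rank-one frame on `W' := W ⊓ U_z`
    let W' : Y.Opens := W ⊓ F.U z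
    let e := SheafOfModules.restrictTrivialisation (R := Y.ringCatSheaf)
      (homOfLE (inf_le_right : W' ≤ F.U z)) (F.frame z)
    let ι : W' ⟶ ⊤ := homOfLE le_top
    let l : W' ⟶ W := homOfLE inf_le_left
    let b : Γ(E, W') := basisSection e default
    let μ' : E.over W' ⟶ (unitModule Y).over W' := restrictHom ι μ
    let cW : Γ(Y, W') := show Γ(Y, W') from appLE μ' (𝟙 W') b
    change E.presheaf.map l.op (c • E.presheaf.map k.op σ) = E.presheaf.map l.op x
    -- the restricted sections in the frame
    set x' : Γ(E, W') := E.presheaf.map l.op x with hx'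
    set σ' : Γ(E, W') := E.presheaf.map ι.op σ with hσ'
    set a : Γ(Y, W') := coord e (𝟙 W') x' default with ha
    set a₀ : Γ(Y, W') := coord e (𝟙 W') σ' default with ha₀
    have hxb : x' = a • b := eq_coord_smul_basisSection_of_unique e x'
    have hσb : σ' = a₀ • b := eq_coord_smul_basisSection_of_unique e σ'
    have hlk : E.presheaf.map l.op (E.presheaf.map k.op σ) = σ' := by
      rw [hσ', ← CategoryTheory.comp_apply, ← Functor.map_comp]
      exact congrArg (fun j => E.presheaf.map j σ) (Subsingleton.elim _ _)
    -- (f1) `c|_{W'} = q| · a · μ(b)`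
    have f1 : Y.presheaf.map l.op c = Y.presheaf.map ι.op q * (a * cW) := by
      rw [hc, map_mul, ← CategoryTheory.comp_apply, ← Functor.map_comp]
      have e1 : Y.presheaf.map (k.op ≫ l.op) q = Y.presheaf.map ι.op q :=
        congrArg (fun j => Y.presheaf.map j q) (Subsingleton.elim _ _)
      have e2 : Y.presheaf.map l.op (show Γ(Y, W) from appLE μ k x) = a * cW := by
        have h := appLE_map μ k l x
        have h' : appLE μ (l ≫ k) x' = appLE μ' (𝟙 W') x' := by
          rw [appLE_restrictHom]
          exact congrArg (fun j => appLE μ j x') (Subsingleton.elim _ _)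
        change (unitModule Y).presheaf.map l.op (appLE μ k x) = _
        rw [← h, ← hx', h', appLE_eq_coord_smul_of_unique e μ' x']
        rfl
      rw [e1, e2]
    -- (f2) `p|_{W'} = a₀ · μ(b)` and (f3) `p| q| = 1`
    have f2 : Y.presheaf.map ι.op p = a₀ * cW := by
      rw [← hμσ ι]
      have h' : appLE μ ι σ' = appLE μ' (𝟙 W') σ' := by
        rw [appLE_restrictHom]
        exact congrArg (fun j => appLE μ j σ') (Subsingleton.elim _ _)
      change appLE μ ι σ' = _
      rw [h', appLE_eq_coord_smul_of_unique e μ' σ']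
      rfl
    have f3 : Y.presheaf.map ι.op p * Y.presheaf.map ι.op q = 1 := by
      rw [← map_mul, hq, map_one]
    rw [Scheme.Modules.map_smul, hlk, hσb, hxb, smul_smul, f1]
    congr 1
    rw [f2] at f3
    linear_combination a * f3
  -- assemble: the isomorphism over `⊤`, restricted to the covering open `⨆_y ⊤`, descends to `E ≅ 𝒪_Y`
  have hW : ∀ y : Y, y ∈ (fun _ : Y => (⊤ : Y.Opens)) y := fun _ => trivial
  let j : iSup (fun _ : Y => (⊤ : Y.Opens)) ⟶ (⊤ : Y.Opens) := homOfLE le_top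
  let Ψ : E.over (iSup fun _ : Y => (⊤ : Y.Opens)) ≅
      (unitModule Y).over (iSup fun _ : Y => (⊤ : Y.Opens)) :=
    ⟨restrictHom j t, restrictHom j s, by rw [← restrictHom_comp, hts, restrictHom_id],
      by rw [← restrictHom_comp, hst, restrictHom_id]⟩
  exact ⟨isoOfOverCover hW Ψ⟩

/-- On an integral scheme, restriction of functions to a non-empty smaller open is injective (private
copy of the tree's `Resolution.presheaf_map_injective_of_isIntegral`, whose import cone is not wanted here).
[cite: Hartshorne1977, II Ex. 3.8 (integral schemes)] -/
private theorem presheaf_map_injective_of_isIntegral [IsIntegral Y] {U V : Y.Opens} (h : V ≤ U) (v : Y)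
    (hv : v ∈ V) : Function.Injective (Y.presheaf.map (homOfLE h).op) := by
  have hg := germ_injective_of_isIntegral (X := Y) (U := U) v (h hv)
  rw [← Y.presheaf.germ_res (homOfLE h) v hv] at hg
  exact Function.Injective.of_comp (by simpa only [CommRingCat.hom_comp, RingHom.coe_comp] using hg)

/-- **On an integral scheme a non-zero functional `μ : E → 𝒪` does not kill a non-zero global section
`σ` of a line bundle `E`**: in a rank-one frame near a point where `σ ≠ 0`, `σ| = a b` with `a ≠ 0` and
`μ(σ)| = a · μ(b)`; so `μ(σ) = 0` forces `μ(b) = 0` (domain), i.e. `μ = 0` on that open, hence everywhere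
(restrictions to non-empty opens are injective on an integral scheme).
[cite: Hartshorne1977, II Ex. 5.1 (b) (p. 123)] [cite: MumfordAV1970, §5 Cor. 6 (p. 54)] -/
theorem appLE_ne_zero_of_ne_zero [IsIntegral Y] (hE : HasRank E 1) {σ : Γ(E, ⊤)} (hσ : σ ≠ 0)
    {μ : E.over ⊤ ⟶ (unitModule Y).over ⊤} (hμ : μ ≠ 0) :
    (show Γ(Y, ⊤) from appLE μ (𝟙 ⊤) σ) ≠ 0 := by
  obtain ⟨F, hF⟩ := exists_frameSystem_of_hasRank hE
  -- (1) a frame open on which `σ` does not vanish (sheaf locality)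
  obtain ⟨z, hz⟩ : ∃ z : Y, E.presheaf.map (homOfLE (le_top : F.U z ≤ ⊤)).op σ ≠ 0 := by
    by_contra h
    push Not at h
    apply hσ
    refine TopCat.Sheaf.eq_of_locally_eq' (C := AddCommGrpCat.{u}) ⟨E.presheaf, E.isSheaf⟩ F.U ⊤
      (fun z => homOfLE le_top) (fun z _ => Opens.mem_iSup.mpr ⟨z, F.mem z⟩) σ 0 fun z => ?_
    change E.presheaf.map (homOfLE (le_top : F.U z ≤ ⊤)).op σ =
      E.presheaf.map (homOfLE (le_top : F.U z ≤ ⊤)).op 0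
    rw [h z, map_zero]
  haveI : Unique (F.I z) := ((F.enum z).trans (finCongr (hF z))).unique
  intro hp
  -- (2) in the frame at `z`: `σ| = a • b`, `a ≠ 0`, `μ(σ)| = a * μ(b) = 0`, so `μ(b) = 0`
  let U : Y.Opens := F.U z
  let ι : U ⟶ ⊤ := homOfLE le_top
  let e := F.frame z
  let b : Γ(E, U) := basisSection e default
  let μ' : E.over U ⟶ (unitModule Y).over U := restrictHom ι μ
  let c : Γ(Y, U) := show Γ(Y, U) from appLE μ' (𝟙 U) b
  set σ' : Γ(E, U) := E.presheaf.map ι.op σ with hσ'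
  set a : Γ(Y, U) := coord e (𝟙 U) σ' default with ha
  have hσb : σ' = a • b := eq_coord_smul_basisSection_of_unique e σ'
  have ha0 : a ≠ 0 := fun h => hz (by change σ' = 0; rw [hσb, h, zero_smul])
  have hac : a * c = 0 := by
    have h1 : (show Γ(Y, U) from appLE μ ι σ') =
        Y.presheaf.map ι.op (show Γ(Y, ⊤) from appLE μ (𝟙 ⊤) σ) := by
      have h := appLE_map μ (𝟙 ⊤) ι σ
      rw [Category.comp_id] at h
      exact h
    have h2 : appLE μ ι σ' = appLE μ' (𝟙 U) σ' := by
      rw [appLE_restrictHom]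
      exact congrArg (fun j => appLE μ j σ') (Subsingleton.elim _ _)
    have h3 : (show Γ(Y, U) from appLE μ' (𝟙 U) σ') = a * c := by
      change appLE μ' (𝟙 U) σ' = _
      rw [appLE_eq_coord_smul_of_unique e μ' σ']
      rfl
    rw [← h3, ← h2]
    change (show Γ(Y, U) from appLE μ ι σ') = 0
    rw [h1, hp, map_zero]
  haveI : Nonempty U := ⟨⟨z, F.mem z⟩⟩
  have hc : c = 0 := (mul_eq_zero.mp hac).resolve_left ha0
  -- (3) `μ|_U = 0`
  have hμ' : μ' = 0 := hom_ext_of_basisSection e fun i => by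
    obtain rfl : i = default := Unique.eq_default i
    rw [appLE_zero]
    exact hc
  -- (4) `μ = 0`: test on every section over every open `W`, restricting to `W ⊓ U`
  apply hμ
  refine hom_ext_of_appLE fun W k x => ?_
  rw [appLE_zero]
  by_cases hW : Nonempty W
  · obtain ⟨⟨w, hw⟩⟩ := hW
    -- `W ⊓ U` is non-empty (irreducibility)
    obtain ⟨v, hvW, hvU⟩ := nonempty_preirreducible_inter W.isOpen U.isOpen ⟨w, hw⟩ ⟨z, F.mem z⟩
    have hinj := presheaf_map_injective_of_isIntegral (inf_le_left : W ⊓ U ≤ W) v ⟨hvW, hvU⟩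
    apply hinj
    change (unitModule Y).presheaf.map (homOfLE (inf_le_left : W ⊓ U ≤ W)).op (appLE μ k x) =
      Y.presheaf.map (homOfLE (inf_le_left : W ⊓ U ≤ W)).op 0
    rw [map_zero, ← appLE_map]
    have h4 : appLE μ (homOfLE (inf_le_left : W ⊓ U ≤ W) ≫ k)
        (E.presheaf.map (homOfLE (inf_le_left : W ⊓ U ≤ W)).op x) =
        appLE μ' (homOfLE (inf_le_right : W ⊓ U ≤ U))
          (E.presheaf.map (homOfLE (inf_le_left : W ⊓ U ≤ W)).op x) := by
      rw [appLE_restrictHom]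
      exact congrArg (fun j => appLE μ j _) (Subsingleton.elim _ _)
    rw [h4, hμ', appLE_zero]
    rfl
  · -- `W = ⊥`: the ring `Γ(Y, W)` is trivial
    have hW' : W = ⊥ := by
      ext y
      simp only [Opens.coe_bot, Set.mem_empty_iff_false, iff_false]
      exact fun hy => hW ⟨⟨y, hy⟩⟩
    haveI : Subsingleton Γ(Y, W) :=
      CommRingCat.subsingleton_of_isTerminal ((Y.sheaf).isTerminalOfEqEmpty hW')
    exact Subsingleton.elim (α := Γ(Y, W)) _ _

end Literature.AlgebraicGeometry.Modules

end
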